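import Mathlib
import Summits.ValiantsHypothesis.ValiantsHypothesis.Theorems.NewtonUnitEquationsDissociatedUniformGenericDefs

/-!
# Generic stratum of crux `DissociatedUniform` — sorted gaps of a finite set of naturals

Crux stmt-ValiantsHypothesis-5905 (`NewtonUnitEquations.DissociatedUniform`), line `greedy-basis-shadow`, by-product
"generic stratum" (lead c5).  Pure bookkeeping on a finite set `R ⊆ ℕ`: its sorted enumeration `enumN R n`
(`n < R.card`), the gaps `gapN R n = enumN R n - (enumN R (n-1) + 1)` (`gapN R 0 = enumN R 0`), the UNORDERED gap
`ugap R r = #{n ≤ r : every element of R below r is below n}`, the identities `ugap R (enumN R n) = 1 + gapN R n`,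
`∏_{r ∈ R} ugap R r = ∏_{n < R.card} (1 + gapN R n)`, and injectivity of `R ↦ (R.card, gapN R)`. [folklore]
-/

open scoped BigOperators

-- Sub = Summit single-conjunct layout: the duplicated namespace component is mandated by the tree.
set_option linter.dupNamespace false

namespace Summit.ValiantsHypothesis.ValiantsHypothesis.Theorems.NewtonUnitEquationsDissociatedUniform

namespace Generic

/-- Below the cardinality, `enumN` is the order embedding `orderEmbOfFin`. -/
theorem enumN_eq (R : Finset ℕ) {n : ℕ} (h : n < R.card) : enumN R n = R.orderEmbOfFin rfl ⟨n, h⟩ := by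
  simp [enumN, h]

/-- The enumeration takes values in `R`. -/
theorem enumN_mem (R : Finset ℕ) {n : ℕ} (h : n < R.card) : enumN R n ∈ R := by
  rw [enumN_eq R h]; exact Finset.orderEmbOfFin_mem _ _ _

/-- The enumeration is strictly increasing below the cardinality. -/
theorem enumN_lt_enumN (R : Finset ℕ) {n n' : ℕ} (hnn' : n < n') (h' : n' < R.card) : enumN R n < enumN R n' := by
  rw [enumN_eq R (hnn'.trans h'), enumN_eq R h']
  exact (R.orderEmbOfFin rfl).strictMono (Fin.mk_lt_mk.mpr hnn')

/-- The enumeration is monotone below the cardinality. -/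
theorem enumN_le_enumN (R : Finset ℕ) {n n' : ℕ} (hnn' : n ≤ n') (h' : n' < R.card) : enumN R n ≤ enumN R n' := by
  rcases hnn'.lt_or_eq with h | rfl
  · exact (enumN_lt_enumN R h h').le
  · exact le_rfl

/-- Every element of `R` is enumerated. -/
theorem exists_enumN_eq (R : Finset ℕ) {r : ℕ} (hr : r ∈ R) : ∃ n, n < R.card ∧ enumN R n = r := by
  have : r ∈ Set.range (R.orderEmbOfFin rfl) := by rw [Finset.range_orderEmbOfFin]; exact hr
  obtain ⟨s, hs⟩ := this
  exact ⟨s.val, s.isLt, by rw [enumN_eq R s.isLt]; exact hs⟩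

/-- `preN R 0 = 0`. -/
theorem preN_zero (R : Finset ℕ) : preN R 0 = 0 := by simp [preN]

/-- `preN R (n+1) = enumN R n + 1`. -/
theorem preN_succ (R : Finset ℕ) (n : ℕ) : preN R (n + 1) = enumN R n + 1 := by simp [preN]

/-- `preN R n ≤ enumN R n` below the cardinality. -/
theorem preN_le_enumN (R : Finset ℕ) {n : ℕ} (h : n < R.card) : preN R n ≤ enumN R n := by
  rcases n with _ | n
  · simp [preN]
  · rw [preN_succ]; exact enumN_lt_enumN R (Nat.lt_succ_self n) h

/-- `enumN = gapN + preN` below the cardinality (no truncation). -/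
theorem enumN_eq_gapN_add_preN (R : Finset ℕ) {n : ℕ} (h : n < R.card) : enumN R n = gapN R n + preN R n := by
  unfold gapN; have := preN_le_enumN R h; omega

/-- Every element of `R` below `enumN R n` is below `preN R n`. -/
theorem lt_preN_of_lt_enumN (R : Finset ℕ) {n : ℕ} (h : n < R.card) {r' : ℕ} (hr' : r' ∈ R)
    (hlt : r' < enumN R n) : r' < preN R n := by
  obtain ⟨n', hn', rfl⟩ := exists_enumN_eq R hr'
  have hn'n : n' < n := by
    by_contra hge
    exact absurd hlt (not_lt.mpr (enumN_le_enumN R (not_lt.mp hge) hn'))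
  rcases n with _ | n
  · exact absurd hn'n (Nat.not_lt_zero _)
  · rw [preN_succ]
    exact Nat.lt_succ_of_le (enumN_le_enumN R (Nat.le_of_lt_succ hn'n) (lt_trans (Nat.lt_succ_self n) h))

/-- The filter defining `ugap R (enumN R n)` is the interval `[preN R n, enumN R n]`. -/
theorem ugap_filter_eq_Ico (R : Finset ℕ) {n : ℕ} (h : n < R.card) :
    (Finset.range (enumN R n + 1)).filter (fun m => ∀ r' ∈ R, r' < enumN R n → r' < m) =
      Finset.Ico (preN R n) (enumN R n + 1) := by
  ext m
  simp only [Finset.mem_filter, Finset.mem_range, Finset.mem_Ico]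
  constructor
  · rintro ⟨hm, hP⟩
    refine ⟨?_, hm⟩
    rcases n with _ | n
    · simp [preN]
    · rw [preN_succ]
      exact hP _ (enumN_mem R (lt_trans (Nat.lt_succ_self n) h)) (enumN_lt_enumN R (Nat.lt_succ_self n) h)
  · rintro ⟨hpre, hm⟩
    exact ⟨hm, fun r' hr' hlt => lt_of_lt_of_le (lt_preN_of_lt_enumN R h hr' hlt) hpre⟩

/-- `ugap R (enumN R n) = 1 + gapN R n`. -/
theorem ugap_enumN (R : Finset ℕ) {n : ℕ} (h : n < R.card) : ugap R (enumN R n) = 1 + gapN R n := by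
  unfold ugap
  rw [ugap_filter_eq_Ico R h, Nat.card_Ico]
  have := preN_le_enumN R h
  unfold gapN
  omega

/-- Reindexing a product over `R` by the sorted enumeration. -/
theorem prod_range_enumN {M : Type} [CommMonoid M] (R : Finset ℕ) (f : ℕ → M) :
    ∏ n ∈ Finset.range R.card, f (enumN R n) = ∏ r ∈ R, f r := by
  have hR : R = (Finset.range R.card).image (enumN R) := by
    ext r
    simp only [Finset.mem_image, Finset.mem_range]
    constructor
    · intro hr
      obtain ⟨n, hn, hnr⟩ := exists_enumN_eq R hr
      exact ⟨n, hn, hnr⟩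
    · rintro ⟨n, hn, rfl⟩
      exact enumN_mem R hn
  have hinj : Set.InjOn (enumN R) (Finset.range R.card : Set ℕ) := by
    intro n hn n' hn' hnn'
    have hn := Finset.mem_range.mp (Finset.mem_coe.mp hn)
    have hn' := Finset.mem_range.mp (Finset.mem_coe.mp hn')
    rcases lt_trichotomy n n' with hlt | heq | hgt
    · exact absurd hnn' (enumN_lt_enumN R hlt hn').ne
    · exact heq
    · exact absurd hnn'.symm (enumN_lt_enumN R hgt hn).ne
  calc ∏ n ∈ Finset.range R.card, f (enumN R n) = ∏ r ∈ (Finset.range R.card).image (enumN R), f r :=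
        (Finset.prod_image hinj).symm
    _ = ∏ r ∈ R, f r := Finset.prod_congr hR.symm fun _ _ => rfl

/-- `∏_{r ∈ R} ugap R r = ∏_{n < R.card} (1 + gapN R n)`. -/
theorem prod_ugap (R : Finset ℕ) : ∏ r ∈ R, ugap R r = ∏ n ∈ Finset.range R.card, (1 + gapN R n) := by
  rw [← prod_range_enumN R (ugap R)]
  exact Finset.prod_congr rfl fun n hn => ugap_enumN R (Finset.mem_range.mp hn)

/-- Injectivity of `R ↦ (R.card, gapN R)`. -/
theorem eq_of_gapN_eq {R R' : Finset ℕ} (hcard : R.card = R'.card) (hgap : ∀ n, n < R.card → gapN R n = gapN R' n) :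
    R = R' := by
  have henum : ∀ n, n < R.card → enumN R n = enumN R' n := by
    intro n
    induction n with
    | zero =>
        intro h
        rw [enumN_eq_gapN_add_preN R h, enumN_eq_gapN_add_preN R' (hcard ▸ h), hgap 0 h, preN_zero, preN_zero]
    | succ n ih =>
        intro h
        rw [enumN_eq_gapN_add_preN R h, enumN_eq_gapN_add_preN R' (hcard ▸ h), hgap _ h, preN_succ, preN_succ,
          ih (lt_trans (Nat.lt_succ_self n) h)]
  ext r
  constructor
  · intro hr
    obtain ⟨n, hn, rfl⟩ := exists_enumN_eq R hr
    rw [henum n hn]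
    exact enumN_mem R' (hcard ▸ hn)
  · intro hr
    obtain ⟨n, hn, rfl⟩ := exists_enumN_eq R' hr
    rw [← henum n (hcard ▸ hn)]
    exact enumN_mem R (hcard.symm ▸ hn)

/-- Beyond the cardinality the gaps vanish. -/
theorem gapN_eq_zero_of_le (R : Finset ℕ) {n : ℕ} (h : R.card ≤ n) : gapN R n = 0 := by
  unfold gapN
  have : enumN R n = 0 := by simp [enumN, not_lt.mpr h]
  rw [this]; exact Nat.zero_sub _

end Generic

/-- **Registered sub-goal (file `GenericGaps`).**  A finite set of naturals is determined by its cardinality and its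
sorted gaps. -/
theorem generic_eq_of_gapN_eq {R R' : Finset ℕ} (hcard : R.card = R'.card) (hgap : ∀ n, n < R.card → Generic.gapN R n = Generic.gapN R' n) : R = R' :=
  Generic.eq_of_gapN_eq hcard hgap

end Summit.ValiantsHypothesis.ValiantsHypothesis.Theorems.NewtonUnitEquationsDissociatedUniform
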